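import Summits.CriticalPhenomena.PercolationContinuityZ3.Theorems.PercNearOneGluingNoHeavyLowerTailFourPointAtoms
import Summits.CriticalPhenomena.PercolationContinuityZ3.Theorems.PercNearOneGluingNoHeavyLowerTailCubicThreePointGluing
import Literature.Probability.LatticeModels.ProdBernoulliAtomExpansion
import Literature.Probability.Percolation.StrongHarrisThreePoint
import HarnessLib

/-!
# Tools for the separator theorems of Conjecture W: cells joining an absent terminal vanish; `SK3` on the triples through `a` in four-point cells

Support file for crux `stmt-CriticalPhenomena-4575` (master-family programme; Conjecture W = row `Q44` ∀n), seat `prim-l12-p6` gen 28; memo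
`run/shared/lean/prim/prim-l12/FROM-prim-l12-p6-g28-PORT-GLUING-LEAN.md` §0 (9).  Used by `…Q44TerminalPairSeparatorAB/…ACAY` (THEOREM F: W across a
terminal-pair separator) and `…Q44CutTerminal` (THEOREM E).
* `ConjWPort.cell_eq_zero_of_absent` — if the marked point `quad t` lies on no pair of positive weight, every four-point cell whose pattern joins it to a
  different marked point vanishes (union bound over the star of `quad t`, `prodBernoulli_setOf_exists_mem_eq_zero`);
* `ConjWPort.sk3_abc_cells`, `sk3_aby_cells`, `sk3_acy_cells` — Gladkov's three-point strong Harris–Kleitman inequality `SK3` on the triples `{a,b,c}`,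
  `{a,b,y}`, `{a,c,y}` written in the fifteen four-point cells of `(a,b,c,y)` (companions of `Q44PendantA.sk3_bcy_cells`), from
  `Literature.Probability.Percolation.prodBernoulli_threePoint_strongHarris` and the cell dictionary `FourPointAtoms.measureReal_eq_cellSum`.
No definitions, no named facts, no sorries, standard axioms.
[cite: Gladkov2024, Cor. 4.2]
-/

noncomputable section

namespace Summit.CriticalPhenomena.PercolationContinuityZ3.Theorems

namespace ConjWPort

open MeasureTheory Set Literature.Probability.LatticeModels Literature.Probability.Percolation
open FourPointAtoms
open Summit.CriticalPhenomena.PercolationContinuityZ3.Cruxes.AdditiveGluing.TieLine.ConnAtoms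
open scoped Classical

variable {n : ℕ}

/-! ### Cells joining an absent terminal vanish -/

/-- If the marked point `quad t` lies on no pair of positive weight, every cell whose pattern joins it to a different marked point `quad j` vanishes
(union bound over the star of `quad t`). [folklore] -/
theorem cell_eq_zero_of_absent (p : Sym2 (Fin n) → unitInterval) (a b c y : Fin n) (k : Fin 15) (t j : Fin 4)
    (hne : quad a b c y t ≠ quad a b c y j) (hkj : pat4 k t = pat4 k j) (h0 : ∀ u, u ≠ quad a b c y t → (p s(quad a b c y t, u) : ℝ) = 0) :
    cell p a b c y k = 0 := by
  set F : Finset (Sym2 (Fin n)) := (Finset.univ.erase (quad a b c y t)).image (fun u => s(quad a b c y t, u)) with hF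
  have hsub : (atom (quad a b c y) (pat4 k) : Set (BondConfig (Fin n))) ⊆ {ω | ∃ e ∈ F, e ∈ ω} := by
    intro ω hω
    have hreach : (openGraph ω).Reachable (quad a b c y t) (quad a b c y j) := ((mem_atom _).1 hω t j).2 hkj
    obtain ⟨u, hadj⟩ := TerminalGluing.exists_adj_of_reachable_ne hreach hne
    rcases (openGraph_adj ω _ u).1 hadj with ⟨hmem, hne'⟩
    refine ⟨s(quad a b c y t, u), ?_, hmem⟩
    rw [hF, Finset.mem_image]
    exact ⟨u, Finset.mem_erase.2 ⟨fun h => hne' h.symm, Finset.mem_univ u⟩, rfl⟩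
  have hzero : prodBernoulli p {ω | ∃ e ∈ F, e ∈ ω} = 0 := by
    refine prodBernoulli_setOf_exists_mem_eq_zero p F ?_
    intro e he
    rw [hF, Finset.mem_image] at he
    obtain ⟨u, hu, rfl⟩ := he
    exact h0 u (Finset.mem_erase.1 hu).1
  have hle : cell p a b c y k ≤ (prodBernoulli p).real {ω : BondConfig (Fin n) | ∃ e ∈ F, e ∈ ω} := by
    unfold cell; exact measureReal_mono hsub
  have h2 : (prodBernoulli p).real {ω : BondConfig (Fin n) | ∃ e ∈ F, e ∈ ω} = 0 := by
    rw [measureReal_def, hzero, ENNReal.toReal_zero]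
  rw [h2] at hle
  exact le_antisymm hle (cell_nonneg _ _ _ _ _ _)

/-! ### `SK3` on the triples through `a` in four-point cells -/

/-- Gladkov's `SK3` on the triple `(a,b,c)` in four-point cells (any weighting). [cite: Gladkov2024, Cor. 4.2] -/
theorem sk3_abc_cells (w : Sym2 (Fin n) → unitInterval) (a b c y : Fin n) :
    (cell w a b c y 6 + cell w a b c y 11 + cell w a b c y 12) * (cell w a b c y 5 + cell w a b c y 9 + cell w a b c y 10) +
        (cell w a b c y 6 + cell w a b c y 11 + cell w a b c y 12) * (cell w a b c y 3 + cell w a b c y 7 + cell w a b c y 8) +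
        (cell w a b c y 5 + cell w a b c y 9 + cell w a b c y 10) * (cell w a b c y 3 + cell w a b c y 7 + cell w a b c y 8) ≤
      (cell w a b c y 13 + cell w a b c y 14) * (cell w a b c y 0 + cell w a b c y 1 + cell w a b c y 2 + cell w a b c y 4) := by
  have h := prodBernoulli_threePoint_strongHarris w a b c
  have e1 : (prodBernoulli w).real (openConn a b ∩ (openConn a c)ᶜ) = cell w a b c y 6 + cell w a b c y 11 + cell w a b c y 12 := by
    rw [measureReal_eq_cellSum w a b c y (show HasPattern (quad a b c y) (openConn a b ∩ (openConn a c)ᶜ) _ from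
      ((oc a b c y 0 1 rfl rfl).inter (oc a b c y 0 2 rfl rfl).compl))]
    simp (config := {decide := true}) only [ite_true, ite_false]; ring
  have e2 : (prodBernoulli w).real (openConn a c ∩ (openConn a b)ᶜ) = cell w a b c y 5 + cell w a b c y 9 + cell w a b c y 10 := by
    rw [measureReal_eq_cellSum w a b c y (show HasPattern (quad a b c y) (openConn a c ∩ (openConn a b)ᶜ) _ from
      ((oc a b c y 0 2 rfl rfl).inter (oc a b c y 0 1 rfl rfl).compl))]
    simp (config := {decide := true}) only [ite_true, ite_false]; ring
  have e3 : (prodBernoulli w).real (openConn b c ∩ (openConn a b)ᶜ) = cell w a b c y 3 + cell w a b c y 7 + cell w a b c y 8 := by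
    rw [measureReal_eq_cellSum w a b c y (show HasPattern (quad a b c y) (openConn b c ∩ (openConn a b)ᶜ) _ from
      ((oc a b c y 1 2 rfl rfl).inter (oc a b c y 0 1 rfl rfl).compl))]
    simp (config := {decide := true}) only [ite_true, ite_false]; ring
  have e4 : (prodBernoulli w).real (openConn a b ∩ openConn a c) = cell w a b c y 13 + cell w a b c y 14 := by
    rw [measureReal_eq_cellSum w a b c y (show HasPattern (quad a b c y) (openConn a b ∩ openConn a c) _ from
      ((oc a b c y 0 1 rfl rfl).inter (oc a b c y 0 2 rfl rfl)))]
    simp (config := {decide := true}) only [ite_true, ite_false]; ring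
  have e5 : (prodBernoulli w).real ((openConn a b)ᶜ ∩ (openConn a c)ᶜ ∩ (openConn b c)ᶜ) = cell w a b c y 0 + cell w a b c y 1 + cell w a b c y 2 +
        cell w a b c y 4 := by
    rw [measureReal_eq_cellSum w a b c y (show HasPattern (quad a b c y) ((openConn a b)ᶜ ∩ (openConn a c)ᶜ ∩ (openConn b c)ᶜ) _ from
      (((oc a b c y 0 1 rfl rfl).compl.inter (oc a b c y 0 2 rfl rfl).compl).inter (oc a b c y 1 2 rfl rfl).compl))]
    simp (config := {decide := true}) only [ite_true, ite_false]; ring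
  rw [e1, e2, e3, e4, e5] at h
  exact h

/-- Gladkov's `SK3` on the triple `(a,b,y)` in four-point cells (any weighting). [cite: Gladkov2024, Cor. 4.2] -/
theorem sk3_aby_cells (w : Sym2 (Fin n) → unitInterval) (a b c y : Fin n) :
    (cell w a b c y 6 + cell w a b c y 11 + cell w a b c y 13) * (cell w a b c y 4 + cell w a b c y 8 + cell w a b c y 10) +
        (cell w a b c y 6 + cell w a b c y 11 + cell w a b c y 13) * (cell w a b c y 2 + cell w a b c y 7 + cell w a b c y 9) +
        (cell w a b c y 4 + cell w a b c y 8 + cell w a b c y 10) * (cell w a b c y 2 + cell w a b c y 7 + cell w a b c y 9) ≤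
      (cell w a b c y 12 + cell w a b c y 14) * (cell w a b c y 0 + cell w a b c y 1 + cell w a b c y 3 + cell w a b c y 5) := by
  have h := prodBernoulli_threePoint_strongHarris w a b y
  have e1 : (prodBernoulli w).real (openConn a b ∩ (openConn a y)ᶜ) = cell w a b c y 6 + cell w a b c y 11 + cell w a b c y 13 := by
    rw [measureReal_eq_cellSum w a b c y (show HasPattern (quad a b c y) (openConn a b ∩ (openConn a y)ᶜ) _ from
      ((oc a b c y 0 1 rfl rfl).inter (oc a b c y 0 3 rfl rfl).compl))]
    simp (config := {decide := true}) only [ite_true, ite_false]; ring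
  have e2 : (prodBernoulli w).real (openConn a y ∩ (openConn a b)ᶜ) = cell w a b c y 4 + cell w a b c y 8 + cell w a b c y 10 := by
    rw [measureReal_eq_cellSum w a b c y (show HasPattern (quad a b c y) (openConn a y ∩ (openConn a b)ᶜ) _ from
      ((oc a b c y 0 3 rfl rfl).inter (oc a b c y 0 1 rfl rfl).compl))]
    simp (config := {decide := true}) only [ite_true, ite_false]; ring
  have e3 : (prodBernoulli w).real (openConn b y ∩ (openConn a b)ᶜ) = cell w a b c y 2 + cell w a b c y 7 + cell w a b c y 9 := by
    rw [measureReal_eq_cellSum w a b c y (show HasPattern (quad a b c y) (openConn b y ∩ (openConn a b)ᶜ) _ from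
      ((oc a b c y 1 3 rfl rfl).inter (oc a b c y 0 1 rfl rfl).compl))]
    simp (config := {decide := true}) only [ite_true, ite_false]; ring
  have e4 : (prodBernoulli w).real (openConn a b ∩ openConn a y) = cell w a b c y 12 + cell w a b c y 14 := by
    rw [measureReal_eq_cellSum w a b c y (show HasPattern (quad a b c y) (openConn a b ∩ openConn a y) _ from
      ((oc a b c y 0 1 rfl rfl).inter (oc a b c y 0 3 rfl rfl)))]
    simp (config := {decide := true}) only [ite_true, ite_false]; ring
  have e5 : (prodBernoulli w).real ((openConn a b)ᶜ ∩ (openConn a y)ᶜ ∩ (openConn b y)ᶜ) = cell w a b c y 0 + cell w a b c y 1 + cell w a b c y 3 +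
        cell w a b c y 5 := by
    rw [measureReal_eq_cellSum w a b c y (show HasPattern (quad a b c y) ((openConn a b)ᶜ ∩ (openConn a y)ᶜ ∩ (openConn b y)ᶜ) _ from
      (((oc a b c y 0 1 rfl rfl).compl.inter (oc a b c y 0 3 rfl rfl).compl).inter (oc a b c y 1 3 rfl rfl).compl))]
    simp (config := {decide := true}) only [ite_true, ite_false]; ring
  rw [e1, e2, e3, e4, e5] at h
  exact h

/-- Gladkov's `SK3` on the triple `(a,c,y)` in four-point cells (any weighting). [cite: Gladkov2024, Cor. 4.2] -/
theorem sk3_acy_cells (w : Sym2 (Fin n) → unitInterval) (a b c y : Fin n) :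
    (cell w a b c y 5 + cell w a b c y 9 + cell w a b c y 13) * (cell w a b c y 4 + cell w a b c y 8 + cell w a b c y 12) +
        (cell w a b c y 5 + cell w a b c y 9 + cell w a b c y 13) * (cell w a b c y 1 + cell w a b c y 7 + cell w a b c y 11) +
        (cell w a b c y 4 + cell w a b c y 8 + cell w a b c y 12) * (cell w a b c y 1 + cell w a b c y 7 + cell w a b c y 11) ≤
      (cell w a b c y 10 + cell w a b c y 14) * (cell w a b c y 0 + cell w a b c y 2 + cell w a b c y 3 + cell w a b c y 6) := by
  have h := prodBernoulli_threePoint_strongHarris w a c y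
  have e1 : (prodBernoulli w).real (openConn a c ∩ (openConn a y)ᶜ) = cell w a b c y 5 + cell w a b c y 9 + cell w a b c y 13 := by
    rw [measureReal_eq_cellSum w a b c y (show HasPattern (quad a b c y) (openConn a c ∩ (openConn a y)ᶜ) _ from
      ((oc a b c y 0 2 rfl rfl).inter (oc a b c y 0 3 rfl rfl).compl))]
    simp (config := {decide := true}) only [ite_true, ite_false]; ring
  have e2 : (prodBernoulli w).real (openConn a y ∩ (openConn a c)ᶜ) = cell w a b c y 4 + cell w a b c y 8 + cell w a b c y 12 := by
    rw [measureReal_eq_cellSum w a b c y (show HasPattern (quad a b c y) (openConn a y ∩ (openConn a c)ᶜ) _ from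
      ((oc a b c y 0 3 rfl rfl).inter (oc a b c y 0 2 rfl rfl).compl))]
    simp (config := {decide := true}) only [ite_true, ite_false]; ring
  have e3 : (prodBernoulli w).real (openConn c y ∩ (openConn a c)ᶜ) = cell w a b c y 1 + cell w a b c y 7 + cell w a b c y 11 := by
    rw [measureReal_eq_cellSum w a b c y (show HasPattern (quad a b c y) (openConn c y ∩ (openConn a c)ᶜ) _ from
      ((oc a b c y 2 3 rfl rfl).inter (oc a b c y 0 2 rfl rfl).compl))]
    simp (config := {decide := true}) only [ite_true, ite_false]; ring
  have e4 : (prodBernoulli w).real (openConn a c ∩ openConn a y) = cell w a b c y 10 + cell w a b c y 14 := by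
    rw [measureReal_eq_cellSum w a b c y (show HasPattern (quad a b c y) (openConn a c ∩ openConn a y) _ from
      ((oc a b c y 0 2 rfl rfl).inter (oc a b c y 0 3 rfl rfl)))]
    simp (config := {decide := true}) only [ite_true, ite_false]; ring
  have e5 : (prodBernoulli w).real ((openConn a c)ᶜ ∩ (openConn a y)ᶜ ∩ (openConn c y)ᶜ) = cell w a b c y 0 + cell w a b c y 2 + cell w a b c y 3 +
        cell w a b c y 6 := by
    rw [measureReal_eq_cellSum w a b c y (show HasPattern (quad a b c y) ((openConn a c)ᶜ ∩ (openConn a y)ᶜ ∩ (openConn c y)ᶜ) _ from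
      (((oc a b c y 0 2 rfl rfl).compl.inter (oc a b c y 0 3 rfl rfl).compl).inter (oc a b c y 2 3 rfl rfl).compl))]
    simp (config := {decide := true}) only [ite_true, ite_false]; ring
  rw [e1, e2, e3, e4, e5] at h
  exact h

end ConjWPort

end Summit.CriticalPhenomena.PercolationContinuityZ3.Theorems
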